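import Mathlib.Tactic.Ring
import Summits.BirchSwinnertonDyer.BirchSwinnertonDyer.Theorems.Rank2ShaThetaJet
import HarnessLib

/-!
# BirchSwinnertonDyer — rank-2 `Ш[p^∞]` cell, STRUCTURE track: the `θ`-jets to order 4 in `ℤ[P,Q,R,S]` (T23, part 2)

HONEST FRAMING (cell `b2b-bsdr2sha`, run/shared/lean/b2b/bsd-rank2-sha/; STRUCTURE.md v6.49 P-032 candidate (xxxii‴) «T23 = P₄ by series
reversion + 12⁴θ⁴F as the one-screen extension of T22»): COMMUTATIVE ALGEBRA ONLY — the fourth iterates of T21's derivation `D = 12θ`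
on `ℤ[P,Q,R,S]` (`P = E₂`, `Q = E₄ = c₄`, `R = E₆ = −c₆`, `S = Δ⁻¹`) in CLOSED FORM, continuing T22 `Rank2ShaThetaJetOrders` (`D²`, `D³`);
this file imports T21 only (so that it does not wait for T22's hub olean) and expands `D⁴` directly from T21's `D_P … D_S`.
Part 1 (`Rank2ShaLagrangeOrderFour`, Mathlib-only) supplies `P₄`; together they are the order-4 data `F₄ = θ⁴F`, `J₄ = θ⁴j` that
the P-031/P-032 laws evaluate.
* `D4_Q`: `D⁴Q = 120·(7P⁴Q − 28P³R + 42P²Q² − 28PQR + 3Q³ + 4R²)`, i.e. `θ⁴E₄ = (5/864)(…)`;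
* `D4_R`: `D⁴R = 3024·(P⁴R − 4P³Q² + 6P²QR − 2PQ³ − 2PR² + Q²R)`, i.e. `θ⁴E₆ = (7/48)(…)`;
* `D4_j`: `D⁴(Q³S) = 288·S·(46Q⁵ + 117Q²R² + 9P²Q⁴ + 12P²QR² − 95PQ³R − 16PR³ − P³Q²R)`, i.e. `θ⁴j = (1/72)·S·(…)`
  — each by `simp [leibniz]` + `ring` from T21's values on the generators (numerals are `D`-constants).

NOT TYPED: anything analytic or `p`-adic; nothing on BSD, `Ш`, heights. No definition, no named fact, no axiom, no `sorry`.
References: T21 `Rank2ShaThetaJet` (p385294), T22 `Rank2ShaThetaJetOrders` (p388992); structure/theta_alg.py `thetan(F, 4)` (the same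
polynomials times `12⁴`, cross-checked when this file was typed).
-/

set_option autoImplicit false

-- single-conjunct summit: `Summit.BirchSwinnertonDyer.BirchSwinnertonDyer.…` repeats the name by design
set_option linter.dupNamespace false

namespace Summit.BirchSwinnertonDyer.BirchSwinnertonDyer.Rank2Sha.Structure.ThetaJet

open MvPolynomial

/-- numerals are `D`-constants (as T22's `D_ofNat`; private copy so that this file depends on T21 only) -/
private theorem D_ofNat₄ (n : ℕ) [n.AtLeastTwo] : D (ofNat(n) : R₄) = 0 := D.map_natCast n

/-- **`θ⁴c₄`** (`×12⁴`): `D⁴Q = 120·(7P⁴Q − 28P³R + 42P²Q² − 28PQR + 3Q³ + 4R²)`. -/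
theorem D4_Q : D (D (D (D (X .Q)))) =
    120 * (7 * X .P ^ 4 * X .Q - 28 * X .P ^ 3 * X .R + 42 * X .P ^ 2 * X .Q ^ 2 - 28 * X .P * X .Q * X .R + 3 * X .Q ^ 3 +
      4 * X .R ^ 2) := by
  simp only [Derivation.leibniz, map_sub, map_add, D_P, D_Q, D_R, D_ofNat₄, smul_eq_mul, mul_zero, add_zero]
  ring

/-- **`θ⁴E₆`** (`×12⁴`; `c₆ = −E₆`): `D⁴R = 3024·(P⁴R − 4P³Q² + 6P²QR − 2PQ³ − 2PR² + Q²R)`. -/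
theorem D4_R : D (D (D (D (X .R)))) =
    3024 * (X .P ^ 4 * X .R - 4 * X .P ^ 3 * X .Q ^ 2 + 6 * X .P ^ 2 * X .Q * X .R - 2 * X .P * X .Q ^ 3 - 2 * X .P * X .R ^ 2 +
      X .Q ^ 2 * X .R) := by
  simp only [Derivation.leibniz, map_sub, map_add, D_P, D_Q, D_R, D_ofNat₄, smul_eq_mul, mul_zero, add_zero]
  ring

/-- **`θ⁴j`** (`×12⁴`, `j = Q³S`): `D⁴(Q³S) = 288·S·(46Q⁵ + 117Q²R² + 9P²Q⁴ + 12P²QR² − 95PQ³R − 16PR³ − P³Q²R)`. -/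
theorem D4_j : D (D (D (D (X .Q * X .Q * X .Q * X .S)))) =
    288 * X .S * (46 * X .Q ^ 5 + 117 * X .Q ^ 2 * X .R ^ 2 + 9 * X .P ^ 2 * X .Q ^ 4 + 12 * X .P ^ 2 * X .Q * X .R ^ 2 -
      95 * X .P * X .Q ^ 3 * X .R - 16 * X .P * X .R ^ 3 - X .P ^ 3 * X .Q ^ 2 * X .R) := by
  simp only [Derivation.leibniz, map_sub, map_add, map_neg, D_P, D_Q, D_R, D_S, D_ofNat₄, smul_eq_mul,
    mul_zero, add_zero]
  ring

end Summit.BirchSwinnertonDyer.BirchSwinnertonDyer.Rank2Sha.Structure.ThetaJet
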